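import Mathlib.Combinatorics.Hall.Basic
import Mathlib.Data.Fintype.Card
import Mathlib.Algebra.BigOperators.Group.Finset.Basic
import Mathlib.Algebra.BigOperators.Group.Finset.Piecewise
import Mathlib.Algebra.BigOperators.Ring.Finset
import Mathlib.Algebra.Order.BigOperators.Group.Finset
import Mathlib.Data.Finset.Max
import Mathlib.Tactic.Linarith
import Mathlib.Tactic.Ring
import HarnessLib

/-!
# Egerváry's duality theorem for the assignment problem (integral optimal potentials)

Topic `Combinatorics/Optimization`.  For a square array of natural weights `ν : ι × ι → ℕ` there are natural
POTENTIALS `p, q : ι → ℕ` with `p a + q b ≥ ν a b` for all `a, b` and a permutation `σ` all of whose entries are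
TIGHT, `p a + q (σ a) = ν a (σ a)`; consequently `Σ p + Σ q = Σ_a ν a (σ a)` is the maximum weight of a perfect
matching (weak duality `Σ_a ν a (τ a) ≤ Σ p + Σ q` holds for every permutation `τ` and every feasible pair).  This is
J. Egerváry's 1931 theorem (Matrixok kombinatorius tulajdonságairól, Mat. Fiz. Lapok 38, 16–28), the weighted form of
Kőnig's theorem and the correctness statement of Kuhn's Hungarian method (1955); every text on combinatorial
optimization has it (e.g. Schrijver, *Combinatorial Optimization*, Thm 17.1; Korte–Vygen, *Combinatorial Optimization*,
ch. 11).  Mathlib (tag v4.32.0) has Hall's marriage theorem (`Finset.all_card_le_biUnion_card_iff_exists_injective`)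
but no weighted bipartite matching duality (`lean search "Egerv|assignment problem|Hungarian"`, 2026-08-16: nothing).

Proof (the Hungarian step, formalised over `ℤ` and normalised back to `ℕ`): start from the feasible pair
`p a = Σ_b ν a b`, `q = 0`; if the tight edges admit a system of distinct representatives (Hall) we are done; otherwise
Hall's condition fails for some row set `A` with tight neighbourhood `B`, `#B < #A`, and `p − 1_A`, `q + 1_B` is again
feasible with `Σ p + Σ q` smaller by `#A − #B ≥ 1`; the sum is bounded below by `Σ_a ν a a` (weak duality), so the
descent stops.  Wanted by route `ValiantsHypothesis/BorderApolarity` (cruxes stmt-5778 / stmt-14753: de-bordering toric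
representations by ORDER — the least `Σp + Σq` over feasible potentials of the entry-weight matrix of a weighted matrix
pencil is its tropical determinant, Murota 1995).
-/

namespace Literature.Combinatorics.Optimization

open Finset

universe u

/-- **Egerváry's duality theorem** (integral LP duality for the assignment problem): for every square array of natural
weights there are natural potentials `p, q` dominating it (`ν a b ≤ p a + q b`) together with a permutation `σ` of
tight entries (`p a + q (σ a) = ν a (σ a)`), so that `Σ p + Σ q` equals the maximum weight `Σ_a ν a (σ a)` of a perfect
matching. [folklore] -/
def EgervaryDuality : Prop :=
  ∀ (ι : Type u) [Fintype ι] [DecidableEq ι] (ν : ι → ι → ℕ),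
    ∃ (p q : ι → ℕ) (σ : Equiv.Perm ι), (∀ a b, ν a b ≤ p a + q b) ∧ ∀ a, p a + q (σ a) = ν a (σ a)

namespace EgervaryDuality

variable {ι : Type u} [Fintype ι] [DecidableEq ι]

omit [DecidableEq ι] in
/-- Weak duality: a feasible pair of potentials dominates the weight of every permutation. [folklore] -/
theorem sum_perm_le (ν : ι → ι → ℤ) (p q : ι → ℤ) (hfeas : ∀ a b, ν a b ≤ p a + q b) (τ : Equiv.Perm ι) :
    ∑ a, ν a (τ a) ≤ ∑ a, p a + ∑ b, q b := by
  calc ∑ a, ν a (τ a) ≤ ∑ a, (p a + q (τ a)) := Finset.sum_le_sum fun a _ => hfeas a (τ a)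
    _ = ∑ a, p a + ∑ a, q (τ a) := Finset.sum_add_distrib
    _ = ∑ a, p a + ∑ b, q b := by rw [Equiv.sum_comp τ q]

/-- **The Hungarian step.** If no system of distinct tight representatives exists, Hall's condition fails for some row
set `A` with tight neighbourhood `B`, `#B < #A`, and lowering `p` on `A` while raising `q` on `B` by one keeps
feasibility and lowers `Σ p + Σ q`. [folklore] -/
theorem step (ν : ι → ι → ℤ) (p q : ι → ℤ) (hfeas : ∀ a b, ν a b ≤ p a + q b)
    (hno : ¬ ∃ f : ι → ι, Function.Injective f ∧ ∀ a, p a + q (f a) = ν a (f a)) :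
    ∃ p' q' : ι → ℤ, (∀ a b, ν a b ≤ p' a + q' b) ∧ ∑ a, p' a + ∑ b, q' b < ∑ a, p a + ∑ b, q b := by
  classical
  -- tight neighbourhoods
  set t : ι → Finset ι := fun a => univ.filter fun b => p a + q b = ν a b with ht
  have hHall : ¬ ∀ s : Finset ι, #s ≤ #(s.biUnion t) := by
    intro h
    obtain ⟨f, hf, hft⟩ := (Finset.all_card_le_biUnion_card_iff_exists_injective t).mp h
    exact hno ⟨f, hf, fun a => by simpa [ht] using hft a⟩
  push Not at hHall
  obtain ⟨A, hA⟩ := hHall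
  set B : Finset ι := A.biUnion t with hB
  refine ⟨fun a => if a ∈ A then p a - 1 else p a, fun b => if b ∈ B then q b + 1 else q b, ?_, ?_⟩
  · intro a b
    by_cases ha : a ∈ A <;> by_cases hb : b ∈ B <;> simp only [ha, hb, if_true, if_false]
    · linarith [hfeas a b]
    · -- `a ∈ A`, `b ∉ B`: the entry is not tight, so there is slack `≥ 1`
      have hnt : p a + q b ≠ ν a b := by
        intro h
        exact hb (Finset.mem_biUnion.mpr ⟨a, ha, by simp [ht, h]⟩)
      have := hfeas a b
      omega
    · linarith [hfeas a b]
    · exact hfeas a b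
  · -- the sum drops by `#A - #B ≥ 1`
    have hp : ∑ a, (if a ∈ A then p a - 1 else p a) = ∑ a, p a - #A := by
      have h1 : ∀ a, (if a ∈ A then p a - 1 else p a) = p a - (if a ∈ A then (1 : ℤ) else 0) := by
        intro a; split_ifs <;> ring
      simp_rw [h1]
      rw [Finset.sum_sub_distrib, Finset.sum_boole, Finset.filter_mem_eq_inter, Finset.univ_inter]
    have hq : ∑ b, (if b ∈ B then q b + 1 else q b) = ∑ b, q b + #B := by
      have h1 : ∀ b, (if b ∈ B then q b + 1 else q b) = q b + (if b ∈ B then (1 : ℤ) else 0) := by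
        intro b; split_ifs <;> ring
      simp_rw [h1]
      rw [Finset.sum_add_distrib, Finset.sum_boole, Finset.filter_mem_eq_inter, Finset.univ_inter]
    rw [hp, hq]
    have : (#B : ℤ) < #A := by exact_mod_cast hA
    linarith

/-- Egerváry over `ℤ`: every feasible pair of potentials can be driven down to one with a tight permutation
(descent on `Σ p + Σ q`, bounded below by weak duality). [folklore] -/
theorem exists_tight_perm_int (ν : ι → ι → ℤ) :
    ∀ (N : ℕ) (p q : ι → ℤ), (∀ a b, ν a b ≤ p a + q b) →
      ∑ a, p a + ∑ b, q b - ∑ a, ν a a ≤ N →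
      ∃ (p' q' : ι → ℤ) (σ : Equiv.Perm ι), (∀ a b, ν a b ≤ p' a + q' b) ∧ ∀ a, p' a + q' (σ a) = ν a (σ a) := by
  intro N
  induction N with
  | zero =>
    intro p q hfeas hN
    by_cases hex : ∃ f : ι → ι, Function.Injective f ∧ ∀ a, p a + q (f a) = ν a (f a)
    · obtain ⟨f, hf, hft⟩ := hex
      exact ⟨p, q, Equiv.ofBijective f (Finite.injective_iff_bijective.mp hf), hfeas, fun a => hft a⟩
    · obtain ⟨p', q', hfeas', hlt⟩ := step ν p q hfeas hex
      have hweak := sum_perm_le ν p' q' hfeas' (Equiv.refl ι)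
      simp only [Equiv.refl_apply, Nat.cast_zero] at hweak hN
      exact absurd hlt (by linarith)
  | succ k ih =>
    intro p q hfeas hN
    by_cases hex : ∃ f : ι → ι, Function.Injective f ∧ ∀ a, p a + q (f a) = ν a (f a)
    · obtain ⟨f, hf, hft⟩ := hex
      exact ⟨p, q, Equiv.ofBijective f (Finite.injective_iff_bijective.mp hf), hfeas, fun a => hft a⟩
    · obtain ⟨p', q', hfeas', hlt⟩ := step ν p q hfeas hex
      refine ih p' q' hfeas' ?_
      push_cast at hN ⊢
      linarith

omit [DecidableEq ι] in
/-- Normalisation: integer potentials with a tight permutation for natural weights can be shifted to natural ones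
(subtract `min q` from `q`, add it to `p`; a column with `q = 0` keeps every `p a ≥ 0`). [folklore] -/
theorem exists_tight_perm_nat_of_int (ν : ι → ι → ℕ) (p q : ι → ℤ) (σ : Equiv.Perm ι)
    (hfeas : ∀ a b, (ν a b : ℤ) ≤ p a + q b) (htight : ∀ a, p a + q (σ a) = ν a (σ a)) :
    ∃ (p' q' : ι → ℕ), (∀ a b, ν a b ≤ p' a + q' b) ∧ ∀ a, p' a + q' (σ a) = ν a (σ a) := by
  classical
  cases isEmpty_or_nonempty ι with
  | inl h => exact ⟨fun _ => 0, fun _ => 0, fun a => (IsEmpty.false a).elim, fun a => (IsEmpty.false a).elim⟩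
  | inr h =>
    obtain ⟨b₀, -, hb₀⟩ := Finset.exists_min_image (univ : Finset ι) q univ_nonempty
    set c : ℤ := q b₀ with hc
    have hq0 : ∀ b, 0 ≤ q b - c := fun b => by have := hb₀ b (mem_univ b); omega
    have hp0 : ∀ a, 0 ≤ p a + c := fun a => by
      have := hfeas a b₀
      have : (0 : ℤ) ≤ ν a b₀ := Int.natCast_nonneg _
      omega
    refine ⟨fun a => (p a + c).toNat, fun b => (q b - c).toNat, fun a b => ?_, fun a => ?_⟩
    · dsimp only
      have h1 := Int.toNat_of_nonneg (hp0 a)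
      have h2 := Int.toNat_of_nonneg (hq0 b)
      have h3 := hfeas a b
      omega
    · dsimp only
      have h1 := Int.toNat_of_nonneg (hp0 a)
      have h2 := Int.toNat_of_nonneg (hq0 (σ a))
      have h3 := htight a
      omega

end EgervaryDuality

/-- **Egerváry's duality theorem holds.** [folklore] -/
theorem EgervaryDuality_holds : EgervaryDuality.{u} := by
  intro ι _ _ ν
  classical
  -- feasible start: `p a = Σ_b ν a b`, `q = 0`
  set p₀ : ι → ℤ := fun a => ∑ b, (ν a b : ℤ) with hp₀
  have hfeas₀ : ∀ a b, (ν a b : ℤ) ≤ p₀ a + (fun _ => (0 : ℤ)) b := fun a b => by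
    simp only [hp₀, add_zero]
    exact Finset.single_le_sum (f := fun b => (ν a b : ℤ)) (fun b _ => Int.natCast_nonneg _) (mem_univ b)
  obtain ⟨p, q, σ, hfeas, htight⟩ :=
    EgervaryDuality.exists_tight_perm_int (fun a b => (ν a b : ℤ))
      (∑ a, p₀ a + ∑ b : ι, (0 : ℤ) - ∑ a, (ν a a : ℤ)).toNat p₀ (fun _ => 0) hfeas₀ (Int.self_le_toNat _)
  obtain ⟨p', q', h1, h2⟩ := EgervaryDuality.exists_tight_perm_nat_of_int ν p q σ hfeas htight
  exact ⟨p', q', σ, h1, h2⟩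

/-- The optimal value: with Egerváry's potentials, `Σ p + Σ q` is the weight of the tight permutation, which is
therefore a maximum-weight perfect matching (tropical determinant), and `Σ p + Σ q` is the least value over all
feasible natural potentials. [folklore] -/
theorem exists_potentials_sum_eq_tropDet (ι : Type u) [Fintype ι] [DecidableEq ι] (ν : ι → ι → ℕ) :
    ∃ (p q : ι → ℕ) (σ : Equiv.Perm ι), (∀ a b, ν a b ≤ p a + q b) ∧
      ∑ a, p a + ∑ b, q b = ∑ a, ν a (σ a) ∧
      (∀ τ : Equiv.Perm ι, ∑ a, ν a (τ a) ≤ ∑ a, ν a (σ a)) ∧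
      ∀ p' q' : ι → ℕ, (∀ a b, ν a b ≤ p' a + q' b) → ∑ a, p a + ∑ b, q b ≤ ∑ a, p' a + ∑ b, q' b := by
  obtain ⟨p, q, σ, hfeas, htight⟩ := EgervaryDuality_holds ι ν
  have hsum : ∑ a, p a + ∑ b, q b = ∑ a, ν a (σ a) := by
    rw [← Equiv.sum_comp σ q, ← Finset.sum_add_distrib]
    exact Finset.sum_congr rfl fun a _ => htight a
  have hweak : ∀ (p' q' : ι → ℕ), (∀ a b, ν a b ≤ p' a + q' b) → ∀ τ : Equiv.Perm ι,
      ∑ a, ν a (τ a) ≤ ∑ a, p' a + ∑ b, q' b := fun p' q' hfeas' τ =>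
    calc ∑ a, ν a (τ a) ≤ ∑ a, (p' a + q' (τ a)) := Finset.sum_le_sum fun a _ => hfeas' a (τ a)
      _ = ∑ a, p' a + ∑ a, q' (τ a) := Finset.sum_add_distrib
      _ = ∑ a, p' a + ∑ b, q' b := by rw [Equiv.sum_comp τ q']
  exact ⟨p, q, σ, hfeas, hsum, fun τ => hsum ▸ hweak p q hfeas τ, fun p' q' hfeas' => hsum ▸ hweak p' q' hfeas' σ⟩

end Literature.Combinatorics.Optimization
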